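import Literature.NumberTheory.Sieve.LinearEquationsInPrimesLevelTwoInputs
import Mathlib.Topology.Metrizable.Uniformity
import HarnessLib

/-!
# Linear equations in primes, level 2: an explicit compatible metric on the Heisenberg nilmanifold
# — `HeisMetricExists_holds`

Trunk T-SIEVE (`Literature/NumberTheory/Sieve`). This file DISCHARGES the construction statement
`Literature.NumberTheory.Sieve.GreenTaoLevelTwo.HeisMetricExists` of
`LinearEquationsInPrimesLevelTwoInputs.lean`: there is a distance `d` on `H³(ℝ)/H³(ℤ)` with the
five axioms of Green–Tao's Def. 8.1 (a metric inducing the quotient topology, `IsCompatMetric d`)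
that is bi-Lipschitz comparable (`IsBoxComparable d`) to the explicit box pre-distance
`ρ₀(gΓ, hΓ) = inf_{γ ∈ Γ} S(g γ h⁻¹)`, `S(u) = max(‖u‖_∞, ‖u⁻¹‖_∞)` (`heisPreDist`, `boxGauge`).

The metric is the one of Green–Tao, *The quantitative behaviour of polynomial orbits on
nilmanifolds*, Ann. of Math. 175 (2012), Def. 2.2: the LARGEST (pseudo)metric below the
pre-distance, `d(x, y) = inf {∑_{i} ρ₀(x_{i-1}, x_i) : x₀ = x, …, x_n = y}` (here Mathlib's
`PseudoMetricSpace.ofPreNNDist`), shown to be a genuine metric comparable to `ρ₀`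
("`d` really is a metric", loc. cit. App. A, Lemmas A.4–A.5 for general nilmanifolds in Mal'cev
coordinates; for `H³` the coordinates are the matrix entries, Green–Tao 2008a §12). Proof:

* §1 the box gauge: `S ≥ 0`, `S(u⁻¹) = S(u)`, `S(u) = 0 ⇒ u = 1`,
  `S(uv) ≤ S(u) + S(v) + S(u)S(v)` (the only non-linearity of the group law is the cross term
  `x_u y_v` in the `z`-coordinate), continuity, `dist(u, 1) ≤ S(u)`; a conjugate `g δ g⁻¹` of a
  lattice element with `S < ½` is trivial (`x`, `y` are conjugation-invariant integers, then `z`);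
* §2 `ρ₀` is independent of representatives, symmetric, vanishes on the diagonal, and is `≤ 3`
  (representatives in the unit cube, `Heis.exists_mul_mem_cube`);
* §3 the chain metric `d ≤ ρ₀` and the TELESCOPING LEMMA: along a chain of `ρ₀`-length `T`
  the product of the steps `g_i γ_i g_{i+1}⁻¹` has `x, y`-coordinates `≤ T` and `z`-coordinates
  `≤ T(1 + T)`, whence `ρ₀ ≤ T(1+T)`, and with `ρ₀ ≤ 3`: **`ρ₀ ≤ 3 d`**;
* §4 positivity: `ρ₀(p, q) = 0 ⇒ p = q` (two short translates `g γ₁ h⁻¹`, `g γ₂ h⁻¹` differ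
  by the conjugate `g (γ₂γ₁⁻¹) g⁻¹`, which is then trivial);
* §5 `ρ₀`-balls, hence `d`-balls, describe the quotient topology (the quotient map is open;
  right translates of `S`-balls are neighbourhoods);
* §6 `HeisMetricExists_holds` with the comparability constant `L = 3`.

No named facts are introduced (net debt `−1`). With `SharpTwo_holds`
(`LinearEquationsInPrimesLevelTwoSharp.lean`) the level-2 rung then rests on `GITwo` and `MNTwo`
alone (`GreenTao2010_mainTheorem_of_le_four_of_metric_of_GI_of_MN HeisMetricExists_holds`).

## References

* B. Green, T. Tao, *The quantitative behaviour of polynomial orbits on nilmanifolds*, Ann. of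
  Math. (2) 175 (2012), 465–540: Def. 2.2 (the metrics `d_G`, `d_{G/Γ}`), App. A (Lemmas A.4, A.5:
  "`d` really is a metric"; comparability). [GreenTao2012Nilmanifolds]
* B. Green, T. Tao, *An inverse theorem for the Gowers U³(G) norm*, Proc. Edinb. Math. Soc. 51
  (2008), §12 (the Heisenberg nilmanifold, coordinates and the cube metric). [GreenTao2008U3Inverse]
* B. Green, T. Tao, *Linear equations in primes*, Ann. of Math. 171 (2010), Def. 8.1 (the metric
  axioms). [GreenTao2010]
-/

noncomputable section

open Filter Topology NNReal

namespace Literature.NumberTheory.Sieve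

namespace GreenTaoLevelTwo

open Heis

/-! ### §1 The box gauge -/

/-- `S ≥ 0`. [cite: GreenTao2008U3Inverse, §12 (the Heisenberg group in coordinates; the cube metric)] -/
theorem boxGauge_nonneg (u : Heis) : 0 ≤ boxGauge u :=
  le_max_of_le_left (le_max_of_le_left (abs_nonneg _))

/-- `|x| ≤ S`. [cite: GreenTao2008U3Inverse, §12 (the Heisenberg group in coordinates; the cube metric)] -/
theorem abs_x_le_boxGauge (u : Heis) : |u.x| ≤ boxGauge u :=
  le_max_of_le_left (le_max_left _ _)

/-- `|y| ≤ S`. [cite: GreenTao2008U3Inverse, §12 (the Heisenberg group in coordinates; the cube metric)] -/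
theorem abs_y_le_boxGauge (u : Heis) : |u.y| ≤ boxGauge u :=
  le_max_of_le_left (le_max_of_le_right (le_max_left _ _))

/-- `|z| ≤ S`. [cite: GreenTao2008U3Inverse, §12 (the Heisenberg group in coordinates; the cube metric)] -/
theorem abs_z_le_boxGauge (u : Heis) : |u.z| ≤ boxGauge u :=
  le_max_of_le_left (le_max_of_le_right (le_max_right _ _))

/-- `|z(u⁻¹)| ≤ S(u)`. [cite: GreenTao2008U3Inverse, §12 (the Heisenberg group in coordinates; the cube metric)] -/
theorem abs_z_inv_le_boxGauge (u : Heis) : |u⁻¹.z| ≤ boxGauge u :=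
  le_max_of_le_right (le_max_of_le_right (le_max_right _ _))

/-- `S(u⁻¹) = S(u)` (the gauge is symmetrised). [cite: GreenTao2008U3Inverse, §12 (the Heisenberg group in coordinates; the cube metric)] -/
theorem boxGauge_inv (u : Heis) : boxGauge u⁻¹ = boxGauge u := by
  unfold boxGauge
  rw [inv_inv, max_comm]

/-- `S(1) = 0`. [cite: GreenTao2008U3Inverse, §12 (the Heisenberg group in coordinates; the cube metric)] -/
theorem boxGauge_one : boxGauge 1 = 0 := by
  simp [boxGauge]

/-- A bound on the four essential coordinates bounds the gauge.
[cite: GreenTao2008U3Inverse, §12 (the Heisenberg group in coordinates; the cube metric)] -/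
theorem boxGauge_le_of_abs_le {u : Heis} {A : ℝ} (hx : |u.x| ≤ A) (hy : |u.y| ≤ A)
    (hz : |u.z| ≤ A) (hz' : |u⁻¹.z| ≤ A) : boxGauge u ≤ A := by
  unfold boxGauge
  have hx' : |u⁻¹.x| ≤ A := by rw [x_inv, abs_neg]; exact hx
  have hy' : |u⁻¹.y| ≤ A := by rw [y_inv, abs_neg]; exact hy
  exact max_le (max_le hx (max_le hy hz)) (max_le hx' (max_le hy' hz'))

/-- `S(u) = 0` only for `u = 1`. [cite: GreenTao2008U3Inverse, §12 (the Heisenberg group in coordinates; the cube metric)] -/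
theorem eq_one_of_boxGauge_eq_zero {u : Heis} (h : boxGauge u = 0) : u = 1 := by
  have hx : |u.x| ≤ 0 := h ▸ abs_x_le_boxGauge u
  have hy : |u.y| ≤ 0 := h ▸ abs_y_le_boxGauge u
  have hz : |u.z| ≤ 0 := h ▸ abs_z_le_boxGauge u
  apply Heis.ext
  · rw [x_one]; exact abs_nonpos_iff.1 hx
  · rw [y_one]; exact abs_nonpos_iff.1 hy
  · rw [z_one]; exact abs_nonpos_iff.1 hz

/-- `S(uv) ≤ S(u) + S(v) + S(u)S(v)` (the cross term `x_u y_v` in the `z`-coordinate).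
[cite: GreenTao2008U3Inverse, §12 (the Heisenberg group in coordinates; the cube metric)] -/
theorem boxGauge_mul_le (u v : Heis) :
    boxGauge (u * v) ≤ boxGauge u + boxGauge v + boxGauge u * boxGauge v := by
  have hu := boxGauge_nonneg u
  have hv := boxGauge_nonneg v
  have hux := abs_x_le_boxGauge u
  have huy := abs_y_le_boxGauge u
  have huz := abs_z_le_boxGauge u
  have huz' := abs_z_inv_le_boxGauge u
  have hvx := abs_x_le_boxGauge v
  have hvy := abs_y_le_boxGauge v
  have hvz := abs_z_le_boxGauge v
  have hvz' := abs_z_inv_le_boxGauge v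
  rw [z_inv] at huz' hvz'
  apply boxGauge_le_of_abs_le
  · rw [x_mul]
    calc |u.x + v.x| ≤ |u.x| + |v.x| := abs_add_le _ _
      _ ≤ _ := by nlinarith
  · rw [y_mul]
    calc |u.y + v.y| ≤ |u.y| + |v.y| := abs_add_le _ _
      _ ≤ _ := by nlinarith
  · rw [z_mul]
    calc |u.z + v.z + u.x * v.y| ≤ |u.z| + |v.z| + |u.x| * |v.y| := by
          calc |u.z + v.z + u.x * v.y| ≤ |u.z + v.z| + |u.x * v.y| := abs_add_le _ _
            _ ≤ |u.z| + |v.z| + |u.x * v.y| := by linarith [abs_add_le u.z v.z]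
            _ = _ := by rw [abs_mul]
      _ ≤ _ := by nlinarith [abs_nonneg u.x, abs_nonneg v.y]
  · have e : (u * v)⁻¹.z = (-v.z + v.x * v.y) + (-u.z + u.x * u.y) + (-v.x) * (-u.y) := by
      simp only [z_inv, x_mul, y_mul, z_mul]; ring
    rw [e]
    calc |(-v.z + v.x * v.y) + (-u.z + u.x * u.y) + (-v.x) * (-u.y)|
        ≤ |-v.z + v.x * v.y| + |-u.z + u.x * u.y| + |v.x| * |u.y| := by
          calc _ ≤ |(-v.z + v.x * v.y) + (-u.z + u.x * u.y)| + |(-v.x) * (-u.y)| := abs_add_le _ _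
            _ ≤ |-v.z + v.x * v.y| + |-u.z + u.x * u.y| + |(-v.x) * (-u.y)| := by
                linarith [abs_add_le (-v.z + v.x * v.y) (-u.z + u.x * u.y)]
            _ = _ := by rw [abs_mul, abs_neg, abs_neg]
      _ ≤ _ := by nlinarith [abs_nonneg v.x, abs_nonneg u.y]

/-- The gauge is continuous.
[cite: GreenTao2008U3Inverse, §12 (the Heisenberg group in coordinates; the cube metric)] -/
theorem continuous_heisBoxGauge : Continuous (boxGauge : Heis → ℝ) := by
  unfold boxGauge
  have hi : Continuous (fun u : Heis => u⁻¹) := continuous_inv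
  exact ((continuous_x.abs).max ((continuous_y.abs).max continuous_z.abs)).max
    (((continuous_x.comp hi).abs).max (((continuous_y.comp hi).abs).max (continuous_z.comp hi).abs))

/-- The sup distance to the identity is at most the gauge.
[cite: GreenTao2008U3Inverse, §12 (the Heisenberg group in coordinates; the cube metric)] -/
theorem dist_one_le_boxGauge (u : Heis) : dist u 1 ≤ boxGauge u := by
  have e : dist u 1 = max (dist u.x 0) (max (dist u.y 0) (dist u.z 0)) := rfl
  rw [e, Real.dist_eq, Real.dist_eq, Real.dist_eq, sub_zero, sub_zero, sub_zero]
  exact max_le (abs_x_le_boxGauge u) (max_le (abs_y_le_boxGauge u) (abs_z_le_boxGauge u))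

/-- A small conjugate of a lattice element is trivial.
[cite: GreenTao2010, §8 (Γ = H³(ℤ) discrete and cocompact)] -/
theorem latticeΓ_eq_one_of_boxGauge_conj_lt {g : Heis} {δ : Heis} (hδ : δ ∈ Heis.latticeΓ)
    (h : boxGauge (g * δ * g⁻¹) < 1 / 2) : δ = 1 := by
  obtain ⟨⟨a, ha⟩, ⟨b, hb⟩, ⟨c, hc⟩⟩ := hδ
  have hx := (abs_x_le_boxGauge (g * δ * g⁻¹)).trans_lt h
  have hy := (abs_y_le_boxGauge (g * δ * g⁻¹)).trans_lt h
  have hz := (abs_z_le_boxGauge (g * δ * g⁻¹)).trans_lt h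
  simp only [x_mul, x_inv, y_mul, y_inv, z_mul, z_inv] at hx hy hz
  rw [ha] at hx hz
  rw [hb] at hy hz
  have ha0 : a = 0 := by
    have : |((a : ℤ) : ℝ)| < 1 := by
      have e : g.x + (a : ℝ) + -g.x = a := by ring
      rw [e] at hx; linarith
    rw [← Int.cast_abs, ← Int.cast_one, Int.cast_lt, Int.abs_lt_one_iff] at this; exact this
  have hb0 : b = 0 := by
    have : |((b : ℤ) : ℝ)| < 1 := by
      have e : g.y + (b : ℝ) + -g.y = b := by ring
      rw [e] at hy; linarith
    rw [← Int.cast_abs, ← Int.cast_one, Int.cast_lt, Int.abs_lt_one_iff] at this; exact this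
  rw [hc, ha0, hb0] at hz
  push_cast at hz
  have hc0 : c = 0 := by
    have : |((c : ℤ) : ℝ)| < 1 := by
      have e : g.z + (c : ℝ) + g.x * 0 + (-g.z + g.x * g.y) + (g.x + 0) * -g.y = c := by ring
      rw [e] at hz; linarith
    rw [← Int.cast_abs, ← Int.cast_one, Int.cast_lt, Int.abs_lt_one_iff] at this; exact this
  apply Heis.ext
  · rw [ha, ha0, x_one]; simp
  · rw [hb, hb0, y_one]; simp
  · rw [hc, hc0, z_one]; simp

/-! ### §2 The box pre-distance: representatives, symmetry, bounds -/

/-- The gauges of the translates `g γ h⁻¹` are bounded below (by `0`). [cite: GreenTao2008U3Inverse, §12 (the Heisenberg group in coordinates; the cube metric)] -/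
theorem bddBelow_range_boxGauge (g h : Heis) :
    BddBelow (Set.range fun γ : Heis.latticeΓ => boxGauge (g * γ * h⁻¹)) :=
  ⟨0, by rintro _ ⟨γ, rfl⟩; exact boxGauge_nonneg _⟩

/-- The pre-distance does not depend on the representatives.
[cite: GreenTao2012Nilmanifolds, Def. 2.2 and App. A] -/
theorem heisPreDist_mk (g h : Heis) :
    heisPreDist (g : HX) (h : HX) = ⨅ γ : Heis.latticeΓ, boxGauge (g * γ * h⁻¹) := by
  unfold heisPreDist
  obtain ⟨γ₁, h₁⟩ := QuotientGroup.mk_out_eq_mul Heis.latticeΓ g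
  obtain ⟨γ₂, h₂⟩ := QuotientGroup.mk_out_eq_mul Heis.latticeΓ h
  rw [h₁, h₂]
  let e : Heis.latticeΓ ≃ Heis.latticeΓ := (Equiv.mulLeft γ₁).trans (Equiv.mulRight γ₂⁻¹)
  rw [← e.surjective.iInf_comp (fun γ : Heis.latticeΓ => boxGauge (g * γ * h⁻¹))]
  refine iInf_congr fun γ => ?_
  congr 1
  simp only [e, Equiv.trans_apply, Equiv.coe_mulLeft, Equiv.coe_mulRight, Subgroup.coe_mul,
    Subgroup.coe_inv, mul_inv_rev]
  group

/-- `ρ₀(gΓ, hΓ) ≤ S(g γ h⁻¹)` for every `γ ∈ Γ`. [cite: GreenTao2012Nilmanifolds, Def. 2.2 and App. A] -/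
theorem heisPreDist_mk_le (g h : Heis) (γ : Heis.latticeΓ) :
    heisPreDist (g : HX) (h : HX) ≤ boxGauge (g * γ * h⁻¹) := by
  rw [heisPreDist_mk]
  exact ciInf_le (bddBelow_range_boxGauge g h) γ

/-- `ρ₀ ≥ 0`. [cite: GreenTao2012Nilmanifolds, Def. 2.2 and App. A] -/
theorem heisPreDist_nonneg (p q : HX) : 0 ≤ heisPreDist p q :=
  le_ciInf fun _ => boxGauge_nonneg _

/-- Near-minimisers of the infimum defining `ρ₀`. [cite: GreenTao2012Nilmanifolds, Def. 2.2 and App. A] -/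
theorem exists_boxGauge_lt {g h : Heis} {ε : ℝ} (hε : heisPreDist (g : HX) (h : HX) < ε) :
    ∃ γ : Heis.latticeΓ, boxGauge (g * γ * h⁻¹) < ε := by
  rw [heisPreDist_mk] at hε
  exact exists_lt_of_ciInf_lt hε

/-- `ρ₀(p, p) = 0`. [cite: GreenTao2012Nilmanifolds, Def. 2.2 and App. A] -/
theorem heisPreDist_self (p : HX) : heisPreDist p p = 0 := by
  obtain ⟨g, rfl⟩ := QuotientGroup.mk_surjective p
  refine le_antisymm ((heisPreDist_mk_le g g 1).trans ?_) (heisPreDist_nonneg _ _)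
  simp [boxGauge_one]

/-- `ρ₀` is symmetric (`S(u⁻¹) = S(u)` and `γ ↦ γ⁻¹`). [cite: GreenTao2012Nilmanifolds, Def. 2.2 and App. A] -/
theorem heisPreDist_comm (p q : HX) : heisPreDist p q = heisPreDist q p := by
  obtain ⟨g, rfl⟩ := QuotientGroup.mk_surjective p
  obtain ⟨h, rfl⟩ := QuotientGroup.mk_surjective q
  have key : ∀ g h : Heis, heisPreDist (h : HX) (g : HX) ≤ heisPreDist (g : HX) (h : HX) := by
    intro g h
    rw [heisPreDist_mk g h]
    refine le_ciInf fun γ => ?_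
    have e : boxGauge (h * ((γ⁻¹ : Heis.latticeΓ) : Heis) * g⁻¹) = boxGauge (g * γ * h⁻¹) := by
      rw [← boxGauge_inv (g * γ * h⁻¹)]
      congr 1
      simp only [Subgroup.coe_inv, mul_inv_rev, inv_inv, mul_assoc]
    exact (heisPreDist_mk_le h g γ⁻¹).trans_eq e
  exact le_antisymm (key h g) (key g h)

/-- The nilmanifold is bounded for the pre-distance: `ρ₀ ≤ 3` (representatives in the unit cube).
[cite: GreenTao2010, §8 (compactness of G/Γ: the unit cube is a fundamental domain)] -/
theorem heisPreDist_le_three (p q : HX) : heisPreDist p q ≤ 3 := by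
  obtain ⟨g₀, rfl⟩ := QuotientGroup.mk_surjective p
  obtain ⟨h₀, rfl⟩ := QuotientGroup.mk_surjective q
  obtain ⟨γ, hγ, hgx, hgy, hgz⟩ := Heis.exists_mul_mem_cube g₀
  obtain ⟨γ', hγ', hhx, hhy, hhz⟩ := Heis.exists_mul_mem_cube h₀
  rw [← QuotientGroup.mk_mul_of_mem g₀ hγ, ← QuotientGroup.mk_mul_of_mem h₀ hγ']
  set g := g₀ * γ
  set h := h₀ * γ'
  refine (heisPreDist_mk_le g h 1).trans ?_
  rw [Subgroup.coe_one, mul_one]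
  rw [Set.mem_Icc] at hgx hgy hgz hhx hhy hhz
  apply boxGauge_le_of_abs_le
  · rw [x_mul, x_inv, abs_le]; constructor <;> linarith
  · rw [y_mul, y_inv, abs_le]; constructor <;> linarith
  · rw [z_mul, z_inv, y_inv, abs_le]; constructor <;> nlinarith
  · simp only [z_inv, x_mul, y_mul, z_mul, x_inv, y_inv]
    rw [abs_le]; constructor <;> nlinarith

/-! ### §4 Positivity: `ρ₀(p, q) = 0` only if `p = q` (discreteness of `Γ` under conjugation) -/

/-- **Non-degeneracy**: `ρ₀(p, q) = 0` only if `p = q` — two short translates `g γ₁ h⁻¹`, `g γ₂ h⁻¹` differ by the conjugate `g(γ₂γ₁⁻¹)g⁻¹`, which is short, hence trivial.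
[cite: GreenTao2012Nilmanifolds, App. A ("d really is a metric": non-degeneracy)] -/
theorem eq_of_heisPreDist_eq_zero {p q : HX} (h0 : heisPreDist p q = 0) : p = q := by
  obtain ⟨g, rfl⟩ := QuotientGroup.mk_surjective p
  obtain ⟨h, rfl⟩ := QuotientGroup.mk_surjective q
  obtain ⟨γ₁, h₁⟩ := exists_boxGauge_lt (g := g) (h := h) (ε := 1 / 5) (by rw [h0]; norm_num)
  set u₁ := g * γ₁ * h⁻¹ with hu₁
  have hS : boxGauge u₁ = 0 := by
    by_contra hne
    have hpos : 0 < boxGauge u₁ := lt_of_le_of_ne (boxGauge_nonneg _) (Ne.symm hne)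
    obtain ⟨γ₂, h₂⟩ := exists_boxGauge_lt (g := g) (h := h) (ε := min (boxGauge u₁) (1 / 5))
      (by rw [h0]; exact lt_min hpos (by norm_num))
    set u₂ := g * γ₂ * h⁻¹ with hu₂
    have h₂a : boxGauge u₂ < boxGauge u₁ := lt_of_lt_of_le h₂ (min_le_left _ _)
    have h₂b : boxGauge u₂ < 1 / 5 := lt_of_lt_of_le h₂ (min_le_right _ _)
    -- the conjugate `g (γ₂ γ₁⁻¹) g⁻¹ = u₂ u₁⁻¹` is small, hence `γ₂ = γ₁`
    have hconj : g * ((γ₂ * γ₁⁻¹ : Heis.latticeΓ) : Heis) * g⁻¹ = u₂ * u₁⁻¹ := by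
      simp only [hu₁, hu₂, Subgroup.coe_mul, Subgroup.coe_inv, mul_inv_rev, inv_inv]
      group
    have hsmall : boxGauge (g * ((γ₂ * γ₁⁻¹ : Heis.latticeΓ) : Heis) * g⁻¹) < 1 / 2 := by
      rw [hconj]
      have hb := boxGauge_mul_le u₂ u₁⁻¹
      rw [boxGauge_inv] at hb
      have hu1 : boxGauge u₁ < 1 / 5 := h₁
      have hu2n := boxGauge_nonneg u₂
      nlinarith
    have hδ := latticeΓ_eq_one_of_boxGauge_conj_lt (γ₂ * γ₁⁻¹).2 hsmall
    have hγ : γ₂ = γ₁ := by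
      have : (γ₂ * γ₁⁻¹ : Heis.latticeΓ) = 1 := Subtype.ext hδ
      exact mul_inv_eq_one.1 this
    rw [hu₂, hγ] at h₂a
    exact lt_irrefl _ h₂a
  have hu : u₁ = 1 := eq_one_of_boxGauge_eq_zero hS
  have hgh : g * γ₁ = h := mul_inv_eq_one.1 hu
  rw [← hgh, QuotientGroup.mk_mul_of_mem g γ₁.2]

/-! ### §3 The chain metric generated by `ρ₀` and the comparison `ρ₀ ≤ 3 d` -/

/-- `ρ₀` as an `ℝ≥0`-valued pre-distance (the input of `PseudoMetricSpace.ofPreNNDist`). [cite: GreenTao2012Nilmanifolds, Def. 2.2 and App. A] -/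
def preNN (p q : HX) : ℝ≥0 := ⟨heisPreDist p q, heisPreDist_nonneg p q⟩

/-- Coercion of `preNN`. [cite: GreenTao2012Nilmanifolds, Def. 2.2 and App. A] -/
@[simp] theorem coe_preNN (p q : HX) : (preNN p q : ℝ) = heisPreDist p q := rfl

/-- `preNN p p = 0`. [cite: GreenTao2012Nilmanifolds, Def. 2.2 and App. A] -/
theorem preNN_self (p : HX) : preNN p p = 0 := NNReal.eq (heisPreDist_self p)

/-- `preNN` is symmetric. [cite: GreenTao2012Nilmanifolds, Def. 2.2 and App. A] -/
theorem preNN_comm (p q : HX) : preNN p q = preNN q p := NNReal.eq (heisPreDist_comm p q)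

/-- The maximal pseudometric below `ρ₀` (infimum of `ρ₀`-lengths of chains).
[cite: GreenTao2012Nilmanifolds, Def. 2.2 and App. A] -/
@[reducible] def chainPMS : PseudoMetricSpace HX :=
  PseudoMetricSpace.ofPreNNDist preNN preNN_self preNN_comm

/-- The chain distance `d(p, q) = inf_{p = x₀, …, x_n = q} ∑ ρ₀(x_i, x_{i+1})`.
[cite: GreenTao2012Nilmanifolds, Def. 2.2 and App. A] -/
def chainDist (p q : HX) : ℝ := @dist HX chainPMS.toDist p q

/-- The `ρ₀`-length of the chain `p, l₁, …, l_n, q`.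
[cite: GreenTao2012Nilmanifolds, Def. 2.2 and App. A] -/
def chainSum (p : HX) (l : List HX) (q : HX) : ℝ≥0 := ((p::l).zipWith preNN (l ++ [q])).sum

/-- The chain distance is the infimum of the chain sums. [cite: GreenTao2012Nilmanifolds, Def. 2.2 and App. A] -/
theorem chainDist_eq (p q : HX) : chainDist p q = ((⨅ l : List HX, chainSum p l q : ℝ≥0) : ℝ) :=
  PseudoMetricSpace.dist_ofPreNNDist preNN preNN_self preNN_comm p q

/-- `d ≤ ρ₀` (the one-step chain). [cite: GreenTao2012Nilmanifolds, Def. 2.2 and App. A] -/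
theorem chainDist_le_heisPreDist (p q : HX) : chainDist p q ≤ heisPreDist p q :=
  PseudoMetricSpace.dist_ofPreNNDist_le preNN preNN_self preNN_comm p q

/-- `d(p, p) = 0`. [cite: GreenTao2012Nilmanifolds, Def. 2.2 and App. A] -/
theorem chainDist_self (p : HX) : chainDist p p = 0 := @PseudoMetricSpace.dist_self HX chainPMS p

/-- `d` is symmetric. [cite: GreenTao2012Nilmanifolds, Def. 2.2 and App. A] -/
theorem chainDist_comm (p q : HX) : chainDist p q = chainDist q p :=
  @PseudoMetricSpace.dist_comm HX chainPMS p q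

/-- `d` satisfies the triangle inequality (concatenation of chains). [cite: GreenTao2012Nilmanifolds, Def. 2.2 and App. A] -/
theorem chainDist_triangle (p q r : HX) : chainDist p r ≤ chainDist p q + chainDist q r :=
  @PseudoMetricSpace.dist_triangle HX chainPMS p q r

/-- `d ≥ 0`. [cite: GreenTao2012Nilmanifolds, Def. 2.2 and App. A] -/
theorem chainDist_nonneg (p q : HX) : 0 ≤ chainDist p q := by
  rw [chainDist_eq]; exact NNReal.coe_nonneg _

/-- The one-step chain. [cite: GreenTao2012Nilmanifolds, Def. 2.2 and App. A] -/
@[simp] theorem chainSum_nil (p q : HX) : chainSum p [] q = preNN p q := by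
  simp [chainSum]

/-- Prepending a step to a chain. [cite: GreenTao2012Nilmanifolds, Def. 2.2 and App. A] -/
@[simp] theorem chainSum_cons (p a : HX) (l : List HX) (q : HX) :
    chainSum p (a :: l) q = preNN p a + chainSum a l q := by
  simp [chainSum]

/-- The telescoping invariant: coordinates of a product of short steps.
[cite: GreenTao2012Nilmanifolds, Def. 2.2 and App. A] -/
def ChainInv (u : Heis) (A : ℝ) : Prop :=
  |u.x| ≤ A ∧ |u.y| ≤ A ∧ |u.z| ≤ A * (1 + A) ∧ |u⁻¹.z| ≤ A * (1 + A)

/-- A single short step satisfies the invariant. [cite: GreenTao2012Nilmanifolds, Def. 2.2 and App. A] -/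
theorem chainInv_of_boxGauge_le {u : Heis} {A : ℝ} (h : boxGauge u ≤ A) : ChainInv u A := by
  have hA : 0 ≤ A := (boxGauge_nonneg u).trans h
  have hAA : A ≤ A * (1 + A) := by nlinarith
  exact ⟨(abs_x_le_boxGauge u).trans h, (abs_y_le_boxGauge u).trans h,
    ((abs_z_le_boxGauge u).trans h).trans hAA, ((abs_z_inv_le_boxGauge u).trans h).trans hAA⟩

/-- The invariant bounds the gauge by `A(1 + A)`. [cite: GreenTao2012Nilmanifolds, Def. 2.2 and App. A] -/
theorem boxGauge_le_of_chainInv {u : Heis} {A : ℝ} (h : ChainInv u A) (hA : 0 ≤ A) :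
    boxGauge u ≤ A * (1 + A) := by
  have hAA : A ≤ A * (1 + A) := by nlinarith
  exact boxGauge_le_of_abs_le (h.1.trans hAA) (h.2.1.trans hAA) h.2.2.1 h.2.2.2

/-- One more short step keeps the invariant, with the bounds added.
[cite: GreenTao2012Nilmanifolds, Def. 2.2 and App. A] -/
theorem chainInv_mul {v u : Heis} {s A : ℝ} (hv : boxGauge v ≤ s) (hu : ChainInv u A)
    (hA : 0 ≤ A) : ChainInv (v * u) (s + A) := by
  have hs : 0 ≤ s := (boxGauge_nonneg v).trans hv
  have hvx := (abs_x_le_boxGauge v).trans hv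
  have hvy := (abs_y_le_boxGauge v).trans hv
  have hvz := (abs_z_le_boxGauge v).trans hv
  have hvz' := (abs_z_inv_le_boxGauge v).trans hv
  rw [z_inv] at hvz'
  obtain ⟨hux, huy, huz, huz'⟩ := hu
  rw [z_inv] at huz'
  refine ⟨?_, ?_, ?_, ?_⟩
  · rw [x_mul]
    exact (abs_add_le _ _).trans (by linarith)
  · rw [y_mul]
    exact (abs_add_le _ _).trans (by linarith)
  · rw [z_mul]
    calc |v.z + u.z + v.x * u.y| ≤ |v.z| + |u.z| + |v.x| * |u.y| := by
          calc _ ≤ |v.z + u.z| + |v.x * u.y| := abs_add_le _ _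
            _ ≤ |v.z| + |u.z| + |v.x * u.y| := by linarith [abs_add_le v.z u.z]
            _ = _ := by rw [abs_mul]
      _ ≤ s + A * (1 + A) + s * A := by
          have : |v.x| * |u.y| ≤ s * A := mul_le_mul hvx huy (abs_nonneg _) hs
          linarith
      _ ≤ (s + A) * (1 + (s + A)) := by nlinarith
  · have e : (v * u)⁻¹.z = (-u.z + u.x * u.y) + (-v.z + v.x * v.y) + (-u.x) * (-v.y) := by
      simp only [z_inv, x_mul, y_mul, z_mul]; ring
    rw [e]
    calc |(-u.z + u.x * u.y) + (-v.z + v.x * v.y) + (-u.x) * (-v.y)|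
        ≤ |-u.z + u.x * u.y| + |-v.z + v.x * v.y| + |u.x| * |v.y| := by
          calc _ ≤ |(-u.z + u.x * u.y) + (-v.z + v.x * v.y)| + |(-u.x) * (-v.y)| := abs_add_le _ _
            _ ≤ |-u.z + u.x * u.y| + |-v.z + v.x * v.y| + |(-u.x) * (-v.y)| := by
                linarith [abs_add_le (-u.z + u.x * u.y) (-v.z + v.x * v.y)]
            _ = _ := by rw [abs_mul, abs_neg, abs_neg]
      _ ≤ A * (1 + A) + s + A * s := by
          have : |u.x| * |v.y| ≤ A * s := mul_le_mul hux hvy (abs_nonneg _) hA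
          linarith
      _ ≤ (s + A) * (1 + (s + A)) := by nlinarith

/-- Boundedness below of the gauges over `Γ` (representatives `Quotient.out`). [cite: GreenTao2012Nilmanifolds, Def. 2.2 and App. A] -/
theorem bddBelow_range_out (p q : HX) : BddBelow (Set.range fun γ : Heis.latticeΓ =>
    boxGauge (Quotient.out p * (γ : Heis) * (Quotient.out q)⁻¹)) :=
  ⟨0, by rintro _ ⟨γ, rfl⟩; exact boxGauge_nonneg _⟩

/-- **The telescoping lemma**: along any chain from `p` to `q` of `ρ₀`-length `T`, some
`γ ∈ Γ` has `out(p) γ out(q)⁻¹` with coordinates `O(T + ε)` (`z`-coordinates `O((T+ε)(1+T+ε))`).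
[cite: GreenTao2012Nilmanifolds, App. A (comparison of d with the coordinate pre-distance)] -/
theorem exists_chainInv (l : List HX) : ∀ (p q : HX) (ε : ℝ), 0 < ε →
    ∃ γ : Heis.latticeΓ,
      ChainInv (Quotient.out p * (γ : Heis) * (Quotient.out q)⁻¹) ((chainSum p l q : ℝ) + ε) := by
  induction l with
  | nil =>
    intro p q ε hε
    have hlt : heisPreDist p q < heisPreDist p q + ε := by linarith
    obtain ⟨γ, hγ⟩ := exists_lt_of_ciInf_lt hlt
    refine ⟨γ, ?_⟩
    rw [chainSum_nil, coe_preNN]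
    exact chainInv_of_boxGauge_le hγ.le
  | cons a l ih =>
    intro p q ε hε
    obtain ⟨γ', hγ'⟩ := ih a q (ε / 2) (by positivity)
    have hlt : heisPreDist p a < heisPreDist p a + ε / 2 := by linarith
    obtain ⟨γ₀, hγ₀⟩ := exists_lt_of_ciInf_lt hlt
    refine ⟨γ₀ * γ', ?_⟩
    have e : Quotient.out p * ((γ₀ * γ' : Heis.latticeΓ) : Heis) * (Quotient.out q)⁻¹ =
        (Quotient.out p * (γ₀ : Heis) * (Quotient.out a)⁻¹) *
          (Quotient.out a * (γ' : Heis) * (Quotient.out q)⁻¹) := by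
      simp only [Subgroup.coe_mul]; group
    have eA : ((chainSum p (a :: l) q : ℝ≥0) : ℝ) + ε =
        (heisPreDist p a + ε / 2) + (((chainSum a l q : ℝ≥0) : ℝ) + ε / 2) := by
      rw [chainSum_cons, NNReal.coe_add, coe_preNN]; ring
    rw [e, eA]
    exact chainInv_mul hγ₀.le hγ' (by positivity)

/-- `ρ₀(p,q) ≤ T(1 + T)` for every chain of `ρ₀`-length `T` from `p` to `q`.
[cite: GreenTao2012Nilmanifolds, App. A] -/
theorem heisPreDist_le_chainSum_mul (p q : HX) (l : List HX) :
    heisPreDist p q ≤ (chainSum p l q : ℝ) * (1 + chainSum p l q) := by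
  set T : ℝ := (chainSum p l q : ℝ) with hT
  have hT0 : 0 ≤ T := NNReal.coe_nonneg _
  refine le_of_forall_pos_lt_add fun η hη => ?_
  set ε : ℝ := min 1 (η / (3 + 2 * T)) with hε
  have hε0 : 0 < ε := lt_min zero_lt_one (by positivity)
  have hε1 : ε ≤ 1 := min_le_left _ _
  have hε2 : ε ≤ η / (3 + 2 * T) := min_le_right _ _
  obtain ⟨γ, hInv⟩ := exists_chainInv l p q ε hε0
  have h1 : heisPreDist p q ≤ boxGauge (Quotient.out p * (γ : Heis) * (Quotient.out q)⁻¹) :=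
    ciInf_le (bddBelow_range_out p q) γ
  have h2 := boxGauge_le_of_chainInv hInv (by positivity)
  have h3 : (T + ε) * (1 + (T + ε)) ≤ T * (1 + T) + ε * (2 + 2 * T) := by nlinarith
  have h4 : ε * (2 + 2 * T) < η := by
    have h5 : ε * (3 + 2 * T) ≤ η := by
      have := (le_div_iff₀ (by positivity : (0 : ℝ) < 3 + 2 * T)).1 hε2; linarith
    nlinarith
  linarith

/-- `ρ₀(p,q) ≤ 3 T` for every chain of `ρ₀`-length `T` (using `ρ₀ ≤ 3`).
[cite: GreenTao2012Nilmanifolds, App. A] -/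
theorem heisPreDist_le_three_mul_chainSum (p q : HX) (l : List HX) :
    heisPreDist p q ≤ 3 * (chainSum p l q : ℝ) := by
  have h := heisPreDist_le_chainSum_mul p q l
  have h3 := heisPreDist_le_three p q
  have hT0 : 0 ≤ (chainSum p l q : ℝ) := NNReal.coe_nonneg _
  by_cases hT : (chainSum p l q : ℝ) ≤ 2
  · nlinarith
  · push Not at hT
    linarith

/-- **`ρ₀ ≤ 3 d`**: the chain metric is bi-Lipschitz comparable to the box pre-distance.
[cite: GreenTao2012Nilmanifolds, Def. 2.2 and App. A (comparability of the chain metric with the pre-distance)] -/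
theorem heisPreDist_le_three_mul_chainDist (p q : HX) : heisPreDist p q ≤ 3 * chainDist p q := by
  rw [chainDist_eq, NNReal.coe_iInf]
  have h : heisPreDist p q / 3 ≤ ⨅ l : List HX, ((chainSum p l q : ℝ≥0) : ℝ) :=
    le_ciInf fun l => by
      have := heisPreDist_le_three_mul_chainSum p q l
      linarith
  linarith [(div_le_iff₀ (by norm_num : (0 : ℝ) < 3)).1 h]

/-! ### §5 The chain metric induces the quotient topology -/

/-- `ρ₀`-balls describe the quotient topology of `H³(ℝ)/H³(ℤ)`.
[cite: GreenTao2010, Def. 8.1 (the metric induces the topology of G/Γ)] [cite: GreenTao2012Nilmanifolds, App. A] -/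
theorem isOpen_iff_heisPreDist (U : Set HX) :
    IsOpen U ↔ ∀ p ∈ U, ∃ ε : ℝ, 0 < ε ∧ ∀ q, heisPreDist p q < ε → q ∈ U := by
  constructor
  · intro hU p hp
    obtain ⟨g, rfl⟩ := QuotientGroup.mk_surjective p
    -- `u ↦ (u⁻¹ g)Γ` is continuous and sends `1` to `gΓ ∈ U`
    set φ : Heis → HX := fun u => ((u⁻¹ * g : Heis) : HX) with hφ
    have hφc : Continuous φ :=
      QuotientGroup.continuous_mk.comp (continuous_inv.mul continuous_const)
    have h1 : φ ⁻¹' U ∈ 𝓝 (1 : Heis) := by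
      refine hφc.continuousAt.preimage_mem_nhds (hU.mem_nhds ?_)
      simp [hφ, hp]
    obtain ⟨ε, hε, hball⟩ := Metric.mem_nhds_iff.1 h1
    refine ⟨ε, hε, fun q hq => ?_⟩
    obtain ⟨h, rfl⟩ := QuotientGroup.mk_surjective q
    obtain ⟨γ, hγ⟩ := exists_boxGauge_lt hq
    have hu : g * γ * h⁻¹ ∈ Metric.ball (1 : Heis) ε :=
      Metric.mem_ball.2 ((dist_one_le_boxGauge _).trans_lt hγ)
    have hmem : ((((g * (γ : Heis) * h⁻¹)⁻¹ * g : Heis)) : HX) ∈ U := hball hu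
    have e1 : (g * (γ : Heis) * h⁻¹)⁻¹ * g = h * ((γ⁻¹ : Heis.latticeΓ) : Heis) := by
      simp only [mul_inv_rev, inv_inv, Subgroup.coe_inv]; group
    rw [e1, QuotientGroup.mk_mul_of_mem h (γ⁻¹).2] at hmem
    exact hmem
  · intro H
    have hpre : IsOpen ((QuotientGroup.mk : Heis → HX) ⁻¹' U) := by
      refine Metric.isOpen_iff.2 fun k hk => ?_
      obtain ⟨ε, hε, hb⟩ := H (k : HX) hk
      have hc : Continuous fun k' : Heis => boxGauge (k * k'⁻¹) :=
        continuous_heisBoxGauge.comp (continuous_const.mul continuous_inv)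
      obtain ⟨δ, hδ, hδε⟩ := Metric.continuousAt_iff.1 (hc.continuousAt (x := k)) ε hε
      refine ⟨δ, hδ, fun k' hk' => ?_⟩
      have h1 := hδε hk'
      rw [mul_inv_cancel, boxGauge_one, Real.dist_eq, sub_zero,
        abs_of_nonneg (boxGauge_nonneg _)] at h1
      have h2 : heisPreDist (k : HX) (k' : HX) < ε :=
        lt_of_le_of_lt (by simpa using heisPreDist_mk_le k k' 1) h1
      exact hb _ h2
    rw [← Set.image_preimage_eq U QuotientGroup.mk_surjective]
    exact QuotientGroup.isOpenMap_coe _ hpre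

/-- The chain metric induces the quotient topology.
[cite: GreenTao2010, Def. 8.1 (the metric induces the topology of G/Γ)] [cite: GreenTao2012Nilmanifolds, App. A] -/
theorem isOpen_iff_chainDist (U : Set HX) :
    IsOpen U ↔ ∀ p ∈ U, ∃ ε : ℝ, 0 < ε ∧ ∀ q, chainDist p q < ε → q ∈ U := by
  rw [isOpen_iff_heisPreDist]
  constructor
  · intro H p hp
    obtain ⟨ε, hε, hb⟩ := H p hp
    refine ⟨ε / 3, by positivity, fun q hq => hb q ?_⟩
    linarith [heisPreDist_le_three_mul_chainDist p q]
  · intro H p hp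
    obtain ⟨ε, hε, hb⟩ := H p hp
    exact ⟨ε, hε, fun q hq => hb q ((chainDist_le_heisPreDist p q).trans_lt hq)⟩

/-! ### §6 Assembly -/

/-- **An explicit compatible, box-comparable metric on `H³(ℝ)/H³(ℤ)` exists**: the chain metric of
the box pre-distance `ρ₀` (`ρ₀/3 ≤ d ≤ ρ₀`).
[cite: GreenTao2012Nilmanifolds, Def. 2.2 and App. A] [cite: GreenTao2010, Def. 8.1] -/
theorem HeisMetricExists_holds : HeisMetricExists := by
  refine ⟨chainDist, ⟨chainDist_self, chainDist_comm, chainDist_triangle, fun p q h => ?_,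
    isOpen_iff_chainDist⟩, ⟨3, by norm_num, fun p q => ⟨heisPreDist_le_three_mul_chainDist p q, ?_⟩⟩⟩
  · apply eq_of_heisPreDist_eq_zero
    have := heisPreDist_le_three_mul_chainDist p q
    rw [h] at this
    exact le_antisymm (by linarith) (heisPreDist_nonneg p q)
  · linarith [chainDist_le_heisPreDist p q, heisPreDist_nonneg p q]

end GreenTaoLevelTwo

end Literature.NumberTheory.Sieve

end
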